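import Summits.Ventures.PercRepro2.CaseOneMoves

/-!
# What a residual graph looks like
(blind cell PercRepro2, p1 g22; the positive reading of `Residual`)

`Residual o a₁ a₂ b v E ends` was defined as «no thickening step applies». Here it is read off
positively: a residual graph has **no loop** (`Residual.not_loop`), **no parallel pair**
(`Residual.not_parallel`), and every vertex `w ∉ {o, a₁, a₂, v, b}` has **degree ≠ 1** (a vertex of
degree one is a leaf or carries a loop — `Residual.degree_ne_one`) and **degree ≠ 2** (a vertex of degree
two is a series vertex or carries a loop — `Residual.degree_ne_two`); the degree is the number of edges
at the vertex (`degree`). So the residual class of `closedAt_of_residual` is the class of loopless,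
parallel-free graphs whose unmarked non-statement vertices have degree `0` or `≥ 3` — the residual
class of the typed reduction rules of S5 §2.2 / §2.3. Own code; standard axioms. -/

namespace Summit.Ventures.PercRepro2

namespace CaseOne

universe u

section Degree
variable {V : Type*} [DecidableEq V] {E : Type u} [Fintype E] [DecidableEq E]

/-- The edges at a vertex. -/
def edgesAt (ends : E → Sym2 V) (w : V) : Finset E := Finset.univ.filter (fun e => w ∈ ends e)

/-- The degree of a vertex: the number of edges at it (a loop counts once). -/
def degree (ends : E → Sym2 V) (w : V) : ℕ := (edgesAt ends w).card

omit [DecidableEq E] in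
/-- Membership in the edges at a vertex. -/
lemma mem_edgesAt {ends : E → Sym2 V} {w : V} {e : E} : e ∈ edgesAt ends w ↔ w ∈ ends e := by
  simp [edgesAt]

variable {o a₁ a₂ b v : V} {ends : E → Sym2 V}

omit [DecidableEq V] in
/-- A residual graph has no loop. -/
theorem Residual.not_loop (h : Residual o a₁ a₂ b v E ends) (e₀ : E) (x : V) : ends e₀ ≠ s(x, x) := by
  intro hl
  exact h ⟨_, _, _, _, ThickStep.loop E ends x e₀ hl⟩

omit [DecidableEq V] in
/-- A residual graph has no parallel pair. -/
theorem Residual.not_parallel (h : Residual o a₁ a₂ b v E ends) {e₀ e₁ : E} (hne : e₀ ≠ e₁) :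
    ends e₀ ≠ ends e₁ := by
  intro hpar
  exact h ⟨_, _, _, _, ThickStep.par E ends e₀ e₁ hpar hne⟩

/-- In a residual graph no vertex `w ∉ {o, a₁, a₂, v, b}` has degree one: it would be a leaf (or carry
a loop). -/
theorem Residual.degree_ne_one (h : Residual o a₁ a₂ b v E ends) {w : V} (ho : o ≠ w) (h1 : a₁ ≠ w)
    (h2 : a₂ ≠ w) (hv : v ≠ w) (hb : b ≠ w) : degree ends w ≠ 1 := by
  intro hdeg
  obtain ⟨e₀, he₀⟩ := Finset.card_eq_one.1 hdeg
  have hmem : w ∈ ends e₀ := mem_edgesAt.1 (by rw [he₀]; exact Finset.mem_singleton_self e₀)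
  obtain ⟨x, hx⟩ := Sym2.mem_iff_exists.1 hmem
  by_cases hxw : x = w
  · exact h.not_loop e₀ w (by rw [hx, hxw])
  · -- `w` is a leaf at `x` through `e₀`
    have hl : IsLeafAt ends x w e₀ :=
      { ends_eq := by rw [hx, Sym2.eq_swap]
        unique := fun e he => by
          have : e ∈ edgesAt ends w := mem_edgesAt.2 he
          rw [he₀] at this
          exact Finset.mem_singleton.1 this
        ne := hxw }
    exact h ⟨_, _, _, _, ThickStep.leaf E ends x w e₀ hl ho h1 h2 hv hb⟩

/-- In a residual graph no vertex `w ∉ {o, a₁, a₂, v, b}` has degree two: it would be a series vertex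
(or carry a loop). -/
theorem Residual.degree_ne_two (h : Residual o a₁ a₂ b v E ends) {w : V} (ho : o ≠ w) (h1 : a₁ ≠ w)
    (h2 : a₂ ≠ w) (hv : v ≠ w) (hb : b ≠ w) : degree ends w ≠ 2 := by
  intro hdeg
  obtain ⟨e₀, e₁, hne, he⟩ := Finset.card_eq_two.1 hdeg
  have hmem₀ : w ∈ ends e₀ := mem_edgesAt.1 (by rw [he]; exact Finset.mem_insert_self e₀ {e₁})
  have hmem₁ : w ∈ ends e₁ :=
    mem_edgesAt.1 (by rw [he]; exact Finset.mem_insert_of_mem (Finset.mem_singleton_self e₁))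
  obtain ⟨x, hx⟩ := Sym2.mem_iff_exists.1 hmem₀
  obtain ⟨z, hz⟩ := Sym2.mem_iff_exists.1 hmem₁
  by_cases hxw : x = w
  · exact h.not_loop e₀ w (by rw [hx, hxw])
  by_cases hzw : z = w
  · exact h.not_loop e₁ w (by rw [hz, hzw])
  -- `w` is a series vertex between `x` and `z`
  have hs : IsSeriesAt ends x w z e₀ e₁ :=
    { ends_zero := by rw [hx, Sym2.eq_swap]
      ends_one := hz
      ne := hne
      unique := fun e he' => by
        have : e ∈ edgesAt ends w := mem_edgesAt.2 he'
        rw [he] at this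
        simpa using this
      x_ne := hxw
      z_ne := hzw }
  exact h ⟨_, _, _, _, ThickStep.series E ends x w z e₀ e₁ hs ho h1 h2 hv hb⟩

end Degree

end CaseOne

end Summit.Ventures.PercRepro2
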